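import Literature.NumberTheory.LFunctions.DirichletPolynomialCrudeMVT
import HarnessLib

/-!
# The mean value theorem for Dirichlet series: off-diagonal form and passage to infinite series

Trunk T-ANT (`Literature/NumberTheory/LFunctions`). Proofs only (no definitions, no named facts).
Companion of `DirichletPolynomialCrudeMVT.lean`: there the elementary two-sided mean value theorem
is recorded with the lossy off-diagonal bound `4N(1 + log N) ∑|a_n|²`; here we keep the
off-diagonal terms as they come out of the termwise integration,

* `DirichletMVT.abs_meanSquare_sub_le_offDiag` : for complex `a_n` and real `T`,
  `|∫_0^T |∑_{n=1}^{N} a_n n^{-it}|² dt − T ∑_{n=1}^{N} |a_n|²| ≤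
    ∑_{m ≠ n} |a_m| |a_n| · 2/|log n − log m|`
  (Titchmarsh §7.2 / Ivić §5.1: `|∫_0^T (n/m)^{it} dt| ≤ 2/|log(n/m)|`),

so that arithmetic information on the coefficients (e.g. coefficients supported on prime powers)
can be fed in, and we pass to absolutely convergent Dirichlet SERIES by dominated convergence:

* `DirichletMVT.abs_meanSquare_tsum_sub_le` : for `c : ℕ → ℂ` with `c 0 = 0` and `∑ |c_n| < ∞`,
  if the off-diagonal sums of all truncations are `≤ B`, then for `T ≥ 0`
  `|∫_0^T |∑_n c_n n^{-it}|² dt − T ∑_n |c_n|²| ≤ B`.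

These two are the analytic half of the mean square of Montgomery's Dirichlet series
(`montgomery_dirichletSum_meanSquare`, Goldston 2005, (4.6)); the arithmetic half is
`MontgomeryOffDiagonalSums.lean`.

## References

* E. C. Titchmarsh, *The Theory of the Riemann Zeta-Function*, 2nd ed. (1986), §7.2.
* A. Ivić, *The Riemann Zeta-Function* (1985), §5.1.
* D. A. Goldston, *Notes on pair correlation of zeros and prime numbers*, LMS Lecture Note Ser. 322
  (2005), §4, (4.6).
-/

noncomputable section

open Finset Real MeasureTheory Complex Filter Topology
open scoped ComplexConjugate

namespace Literature.NumberTheory.LFunctions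

namespace DirichletMVT

/-- **Two-sided mean value theorem for Dirichlet polynomials, off-diagonal form** (Titchmarsh
§7.2, first step; Ivić §5.1): for complex `a_n` and real `T`,
`|∫_0^T |∑_{n=1}^{N} a_n n^{-it}|² dt − T ∑_{n=1}^{N} |a_n|²| ≤ ∑_{m ≠ n} |a_m||a_n| · 2/|log n − log m|`
(expand the square, integrate termwise; the diagonal gives `T ∑|a_n|²`, and
`|∫_0^T (n/m)^{it} dt| ≤ 2/|log(n/m)|`, `DirichletMVT.norm_integral_exp_mul_I_le`). [folklore] -/
theorem abs_meanSquare_sub_le_offDiag (a : ℕ → ℂ) (N : ℕ) (T : ℝ) :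
    |(∫ t in (0 : ℝ)..T, ‖∑ n ∈ Finset.Icc 1 N, a n * (n : ℂ) ^ (-((t : ℂ) * I))‖ ^ 2) -
        T * ∑ n ∈ Finset.Icc 1 N, ‖a n‖ ^ 2| ≤
      ∑ m ∈ Finset.Icc 1 N, ∑ n ∈ (Finset.Icc 1 N).erase m,
        ‖a m‖ * ‖a n‖ * (2 / |Real.log n - Real.log m|) := by
  classical
  set s := Finset.Icc 1 N with hs
  -- the phases
  set e : ℕ → ℝ → ℂ := fun n t ↦ Complex.exp ((-(t * Real.log n) : ℝ) * I) with he
  have hDe : ∀ t : ℝ, ∑ n ∈ s, a n * (n : ℂ) ^ (-((t : ℂ) * I)) = ∑ n ∈ s, a n * e n t := by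
    intro t
    refine Finset.sum_congr rfl fun n hn ↦ ?_
    rw [hs, Finset.mem_Icc] at hn
    rw [natCast_cpow_neg_mul_I (by omega)]
  simp_rw [hDe]
  -- the pair phases `E m n t = e_m(t) conj(e_n(t)) = exp(i t (log n - log m))`
  set E : ℕ → ℕ → ℝ → ℂ := fun m n t ↦
    Complex.exp (((t * (Real.log n - Real.log m) : ℝ) : ℂ) * I) with hE
  have heE : ∀ m n t, e m t * conj (e n t) = E m n t := by
    intro m n t
    simp only [he, hE]
    rw [conj_exp_ofReal_mul_I, ← Complex.exp_add]
    congr 1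
    push_cast
    ring
  have hEcont : ∀ m n, Continuous (E m n) := by
    intro m n; simp only [hE]; fun_prop
  -- the integrals `J m n = ∫_0^T E m n`
  set J : ℕ → ℕ → ℂ := fun m n ↦ ∫ t in (0 : ℝ)..T, E m n t with hJ
  have hJdiag : ∀ m, J m m = T := by
    intro m
    simp only [hJ, hE, sub_self, mul_zero, Complex.ofReal_zero, zero_mul, Complex.exp_zero]
    simp
  have hJoff : ∀ m ∈ s, ∀ n ∈ s, m ≠ n → ‖J m n‖ ≤ 2 / |Real.log n - Real.log m| := by
    intro m hm n hn hmn
    rw [hs, Finset.mem_Icc] at hm hn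
    have hL : Real.log n - Real.log m ≠ 0 := by
      intro h
      have : (n : ℝ) = m := by
        have := Real.log_injOn_pos (Set.mem_Ioi.2 (by exact_mod_cast hn.1 : (0 : ℝ) < n))
          (Set.mem_Ioi.2 (by exact_mod_cast hm.1 : (0 : ℝ) < m)) (sub_eq_zero.1 h)
        exact this
      exact hmn (by exact_mod_cast this.symm)
    exact norm_integral_exp_mul_I_le hL T
  -- Step 1: the mean square as a double sum, in `ℂ`
  have hI : (((∫ t in (0 : ℝ)..T, ‖∑ n ∈ s, a n * e n t‖ ^ 2 : ℝ) : ℝ) : ℂ) =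
      ∑ m ∈ s, ∑ n ∈ s, a m * conj (a n) * J m n := by
    rw [← intervalIntegral.integral_ofReal]
    have hpt : ∀ t : ℝ, (((‖∑ n ∈ s, a n * e n t‖ ^ 2 : ℝ) : ℝ) : ℂ) =
        ∑ m ∈ s, ∑ n ∈ s, a m * conj (a n) * E m n t := by
      intro t
      rw [ofReal_norm_sq_sum_eq]
      refine Finset.sum_congr rfl fun m _ ↦ Finset.sum_congr rfl fun n _ ↦ ?_
      rw [map_mul, ← heE]
      ring
    simp_rw [hpt]
    have hint : ∀ m n, IntervalIntegrable (fun t ↦ a m * conj (a n) * E m n t) volume 0 T :=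
      fun m n ↦ (continuous_const.mul (hEcont m n)).intervalIntegrable _ _
    have hint2 : ∀ m : ℕ, IntervalIntegrable (fun t ↦ ∑ n ∈ s, a m * conj (a n) * E m n t)
        volume 0 T := by
      intro m
      have hc : Continuous fun t ↦ ∑ n ∈ s, a m * conj (a n) * E m n t :=
        continuous_finsetSum s fun n _ ↦ continuous_const.mul (hEcont m n)
      exact hc.intervalIntegrable _ _
    rw [intervalIntegral.integral_finsetSum fun m _ ↦ hint2 m]
    refine Finset.sum_congr rfl fun m _ ↦ ?_
    rw [intervalIntegral.integral_finsetSum fun n _ ↦ hint m n]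
    refine Finset.sum_congr rfl fun n _ ↦ ?_
    simp only [hJ]
    rw [intervalIntegral.integral_const_mul]
  -- Step 2: split off the diagonal
  have hsplit : ∑ m ∈ s, ∑ n ∈ s, a m * conj (a n) * J m n =
      (T : ℂ) * ∑ n ∈ s, (((‖a n‖ ^ 2 : ℝ) : ℝ) : ℂ) +
        ∑ m ∈ s, ∑ n ∈ s.erase m, a m * conj (a n) * J m n := by
    rw [Finset.mul_sum, ← Finset.sum_add_distrib]
    refine Finset.sum_congr rfl fun m hm ↦ ?_
    rw [← Finset.add_sum_erase s _ hm, hJdiag, Complex.mul_conj, Complex.normSq_eq_norm_sq]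
    push_cast
    ring
  -- Step 3: the difference is the off-diagonal sum
  have hdiff : ((((∫ t in (0 : ℝ)..T, ‖∑ n ∈ s, a n * e n t‖ ^ 2) -
      T * ∑ n ∈ s, ‖a n‖ ^ 2 : ℝ) : ℝ) : ℂ) = ∑ m ∈ s, ∑ n ∈ s.erase m, a m * conj (a n) * J m n := by
    push_cast
    rw [hI, hsplit]
    push_cast
    ring
  -- Step 4: the bound
  rw [← Real.norm_eq_abs, ← Complex.norm_real, hdiff]
  refine norm_sum_le_of_le _ fun m hm ↦ norm_sum_le_of_le _ fun n hn ↦ ?_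
  obtain ⟨hnm, hn'⟩ := Finset.mem_erase.1 hn
  rw [norm_mul, norm_mul, Complex.norm_conj]
  exact mul_le_mul_of_nonneg_left (hJoff m hm n hn' (Ne.symm hnm)) (by positivity)

/-- **Mean value theorem for absolutely convergent Dirichlet series, off-diagonal form**: for
`c : ℕ → ℂ` with `c 0 = 0` and `∑ |c_n| < ∞`, if the off-diagonal sums
`∑_{m ≠ n ≤ N} |c_m||c_n| · 2/|log n − log m|` of all truncations are `≤ B`, then for `T ≥ 0`
`|∫_0^T |∑_n c_n n^{-it}|² dt − T ∑_n |c_n|²| ≤ B` (the truncations converge boundedly, so the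
integrals converge by dominated convergence, and `∑_{n ≤ N} |c_n|² → ∑_n |c_n|²`). This is the form
in which the Montgomery–Vaughan mean value theorem `∫_0^T |∑ a_n n^{-it}|² = ∑ |a_n|² (T + O(n))`
(Goldston 2005, (4.6)) is consumed, once `B` is supplied by arithmetic. [folklore] -/
theorem abs_meanSquare_tsum_sub_le {c : ℕ → ℂ} (hc : Summable fun n ↦ ‖c n‖) (h0 : c 0 = 0)
    {T : ℝ} (hT : 0 ≤ T) {B : ℝ}
    (hB : ∀ N : ℕ, ∑ m ∈ Finset.Icc 1 N, ∑ n ∈ (Finset.Icc 1 N).erase m,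
        ‖c m‖ * ‖c n‖ * (2 / |Real.log n - Real.log m|) ≤ B) :
    |(∫ t in (0 : ℝ)..T, ‖∑' n, c n * (n : ℂ) ^ (-((t : ℂ) * I))‖ ^ 2) - T * ∑' n, ‖c n‖ ^ 2| ≤
      B := by
  set u : ℕ → ℝ → ℂ := fun n t ↦ c n * (n : ℂ) ^ (-((t : ℂ) * I)) with hu
  -- termwise norm bound
  have hun : ∀ n t, ‖u n t‖ ≤ ‖c n‖ := by
    intro n t
    rcases Nat.eq_zero_or_pos n with rfl | hn
    · simp [hu, h0]
    · simp only [hu, norm_mul]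
      rw [natCast_cpow_neg_mul_I hn.ne', Complex.norm_exp_ofReal_mul_I, mul_one]
  have hu0 : ∀ t, u 0 t = 0 := fun t ↦ by simp [hu, h0]
  have hsum : ∀ t, Summable fun n ↦ u n t := fun t ↦
    Summable.of_norm_bounded hc (hun · t)
  set A : ℝ := ∑' n, ‖c n‖ with hA
  -- partial sums converge
  have hlim : ∀ t, Tendsto (fun N : ℕ ↦ ∑ n ∈ Finset.Icc 1 N, u n t) atTop (𝓝 (∑' n, u n t)) := by
    intro t
    have h1 := (hsum t).hasSum.tendsto_sum_nat
    have h2 := h1.comp (tendsto_add_atTop_nat 1)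
    refine h2.congr fun N ↦ ?_
    simp only [Function.comp]
    exact sum_range_succ_eq_sum_Icc (fun n ↦ u n t) (hu0 t) N
  -- uniform bound on partial sums
  have hbdN : ∀ N t, ‖∑ n ∈ Finset.Icc 1 N, u n t‖ ≤ A := by
    intro N t
    refine (norm_sum_le _ _).trans ?_
    refine (Finset.sum_le_sum fun n _ ↦ hun n t).trans ?_
    exact hc.sum_le_tsum _ (fun n _ ↦ norm_nonneg _)
  -- squares are summable, and their partial sums converge
  have hsqsum : Summable fun n ↦ ‖c n‖ ^ 2 := by
    refine Summable.of_nonneg_of_le (fun n ↦ sq_nonneg _) (fun n ↦ ?_) (hc.mul_left A)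
    have h1 : ‖c n‖ ≤ A := hc.le_tsum n (fun m _ ↦ norm_nonneg _)
    calc ‖c n‖ ^ 2 = ‖c n‖ * ‖c n‖ := sq _
      _ ≤ A * ‖c n‖ := mul_le_mul_of_nonneg_right h1 (norm_nonneg _)
  have hlim2 : Tendsto (fun N : ℕ ↦ ∑ n ∈ Finset.Icc 1 N, ‖c n‖ ^ 2) atTop
      (𝓝 (∑' n, ‖c n‖ ^ 2)) := by
    have h1 := hsqsum.hasSum.tendsto_sum_nat
    have h2 := h1.comp (tendsto_add_atTop_nat 1)
    refine h2.congr fun N ↦ ?_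
    simp only [Function.comp]
    exact sum_range_succ_eq_sum_Icc (fun n ↦ ‖c n‖ ^ 2) (by simp [h0]) N
  -- the finite bound, uniformly in `N`
  have hfin : ∀ N, |(∫ t in (0 : ℝ)..T, ‖∑ n ∈ Finset.Icc 1 N, u n t‖ ^ 2) -
      T * ∑ n ∈ Finset.Icc 1 N, ‖c n‖ ^ 2| ≤ B := fun N ↦
    (abs_meanSquare_sub_le_offDiag c N T).trans (hB N)
  -- dominated convergence on `[0, T]`
  have hcontN : ∀ N, Continuous fun t : ℝ ↦ ‖∑ n ∈ Finset.Icc 1 N, u n t‖ ^ 2 := by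
    intro N
    refine (continuous_norm.comp (continuous_finsetSum _ fun n hn ↦ continuous_const.mul ?_)).pow 2
    rw [Finset.mem_Icc] at hn
    have : (fun t : ℝ ↦ (n : ℂ) ^ (-((t : ℂ) * I))) =
        fun t : ℝ ↦ Complex.exp ((-(t * Real.log n) : ℝ) * I) := by
      funext t; exact natCast_cpow_neg_mul_I (by omega) t
    rw [this]; fun_prop
  have htend : Tendsto (fun N : ℕ ↦ ∫ t in (0 : ℝ)..T, ‖∑ n ∈ Finset.Icc 1 N, u n t‖ ^ 2)
      atTop (𝓝 (∫ t in (0 : ℝ)..T, ‖∑' n, u n t‖ ^ 2)) := by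
    simp_rw [intervalIntegral.integral_of_le hT]
    refine tendsto_integral_of_dominated_convergence (fun _ ↦ A ^ 2) (fun N ↦ ?_) ?_ (fun N ↦ ?_) ?_
    · exact (hcontN N).aestronglyMeasurable
    · exact integrableOn_const (by simp)
    · refine Filter.Eventually.of_forall fun t ↦ ?_
      rw [Real.norm_of_nonneg (by positivity)]
      exact pow_le_pow_left₀ (norm_nonneg _) (hbdN N t) 2
    · refine Filter.Eventually.of_forall fun t ↦ ?_
      exact ((continuous_norm.tendsto _).comp (hlim t)).pow 2
  have hD : Tendsto (fun N : ℕ ↦ |(∫ t in (0 : ℝ)..T, ‖∑ n ∈ Finset.Icc 1 N, u n t‖ ^ 2) -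
      T * ∑ n ∈ Finset.Icc 1 N, ‖c n‖ ^ 2|) atTop
      (𝓝 |(∫ t in (0 : ℝ)..T, ‖∑' n, u n t‖ ^ 2) - T * ∑' n, ‖c n‖ ^ 2|) :=
    (htend.sub (hlim2.const_mul T)).abs
  exact le_of_tendsto' hD hfin

end DirichletMVT

end Literature.NumberTheory.LFunctions
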